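import Mathlib.RepresentationTheory.Homological.GroupCohomology.LowDegree
import Mathlib.LinearAlgebra.Projection
import Literature.AlgebraicGeometry.HodgeTheory.LocallyTrivialExtensionClasses
import Summits.HodgeConjecture.HodgeConjecture.Theorems.LinearSystemTorelliLocalTubeSpanDirectSum

/-!
# Route LinearSystemTorelli — crux `LocalTubeSpan` (stmt-HodgeConjecture-2490): cyclic detection and a central splitting

Helper file (`--supports stmt-HodgeConjecture-2490`, line `Sketch` of the crux chain, cycle 5,
stub `stub_centralSplit`).  The line reduces the crux ("local Schnell theorem", C. Schnell,
*Primitive cohomology and the tube mapping*, Math. Z. 268 (2010) §3, §7) to CYCLIC DETECTION: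
injectivity of Schnell's third map `evalCoinv A : H¹(G, A) → ∏_{g ∈ G} A/(g - 1)A`, i.e. every
*undetected* `1`-cocycle `φ` (`φ g ∈ (g - 1)A` for all `g`) is a coboundary.  This file is a
PORTABILITY lemma for a CENTRAL element `z ∈ G` (geometrically: a central pencil loop, or `-1` in
the monodromy group):

* `localTubeSpan_centralSplit` — if `z` is central and `A = W₁ ⊕ W₂` with `W₁ = ker (z - 1) = A^z`
  and `W₂ = (z - 1)A`, then the third map of `A` is injective iff the third map of the (stable)
  subrepresentation `A^z` is.

Proof.  Both summands are `G`-stable because `ρ(g)` commutes with `ρ(z) - 1`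
(`localTubeSpan_centralSplit_range_le_comap`), so the landed direct-sum portability
`localTubeSpan_injective_evalCoinv_iff_of_isCompl` (file `…LocalTubeSpanDirectSum`) splits
detection for `A` into detection for `W₁` and for `W₂`; and detection for `W₂` is automatic since
`H¹(G, (z - 1)A) = 0` (`localTubeSpan_centralSplit_exists_of_cocycles₁`): for a `1`-cocycle `ψ`
of `W₂`, comparing `ψ(zg) = z·ψ(g) + ψ(z)` with `ψ(gz) = g·ψ(z) + ψ(g)` gives
`(z - 1)ψ(g) = (g - 1)ψ(z)` (`localTubeSpan_centralSplit_cocycle_comm`); `z - 1` is injective on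
`W₂` (its kernel there is `W₁ ⊓ W₂ = 0`, `localTubeSpan_centralSplit_eq_of_sub_eq`) and
`ψ(z) = (z - 1)u` for some `u ∈ W₂` (`(z - 1)A = (z - 1)(W₁ ⊕ W₂) = (z - 1)W₂`,
`localTubeSpan_centralSplit_exists_sub_eq`), whence `(z - 1)ψ(g) = (g - 1)(z - 1)u = (z - 1)(g - 1)u`
and `ψ(g) = (g - 1)u = g·u - u` is a coboundary.  Consequence drawn by the lead: if `-1 ∈ ρ(G)`
(`W₁ = 0`) then `H¹ = 0` and Schnell's Prop. 12 needs no Janssen input.  Pure group cohomology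
over Mathlib (`groupCohomology.cocycles₁`, `mem_cocycles₁_iff`, `Representation.subrepresentation`)
and the tree's vocabulary (`evalCoinv`, `subOneRange`); no named facts, no geometry.
-/

-- `Summit.HodgeConjecture.HodgeConjecture.Theorems` is the mandated namespace (single-conjunct summit:
-- Sub = Summit), which `linter.dupNamespace` flags on every declaration; the lakefile turns the
-- linter off tree-wide (weak option), restated here so stand-alone elaboration is warning-free too.
set_option linter.dupNamespace false

noncomputable section

open CategoryTheory groupCohomology
open Literature.AlgebraicGeometry.HodgeTheory

namespace Summit.HodgeConjecture.HodgeConjecture.Theorems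

universe u

variable {k G : Type u} [Field k] [Group G] (A : Rep k G)

/-! ### A central element: commutation and stability of `(z - 1)A` -/

/-- For a central `z ∈ G`, `ρ(z)` commutes with every `ρ(g)`. [folklore] -/
theorem localTubeSpan_centralSplit_rho_comm (z : G) (hz : ∀ g : G, g * z = z * g) (g : G)
    (x : A.V) : A.ρ z (A.ρ g x) = A.ρ g (A.ρ z x) := by
  change (A.ρ z * A.ρ g) x = (A.ρ g * A.ρ z) x
  rw [← map_mul, ← map_mul, hz g]

/-- For a central `z ∈ G`, the submodule `(z - 1)A = range (ρ(z) - id)` is `G`-stable: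
`g·(z·x - x) = z·(g·x) - g·x`. [folklore] -/
theorem localTubeSpan_centralSplit_range_le_comap (z : G) (hz : ∀ g : G, g * z = z * g) (g : G) :
    LinearMap.range (A.ρ z - LinearMap.id) ≤
      (LinearMap.range (A.ρ z - LinearMap.id)).comap (A.ρ g) := by
  rintro _ ⟨x, rfl⟩
  rw [Submodule.mem_comap, LinearMap.mem_range]
  refine ⟨A.ρ g x, ?_⟩
  simp only [LinearMap.sub_apply, LinearMap.id_apply, map_sub]
  rw [localTubeSpan_centralSplit_rho_comm A z hz g x]

/-! ### `z - 1` is bijective on the complement of `ker (z - 1)` -/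

/-- If `A = ker (z - 1) ⊕ W₂` then `z - 1` is injective on `W₂`: its kernel there is
`ker (z - 1) ⊓ W₂ = 0`. [folklore] -/
theorem localTubeSpan_centralSplit_eq_of_sub_eq (z : G) (W₁ W₂ : Submodule k A.V)
    (hW₁ : W₁ = LinearMap.ker (A.ρ z - LinearMap.id)) (hc : IsCompl W₁ W₂)
    {w w' : A.V} (hw : w ∈ W₂) (hw' : w' ∈ W₂) (h : A.ρ z w - w = A.ρ z w' - w') :
    w = w' := by
  rw [← sub_eq_zero]
  refine Submodule.disjoint_def.1 hc.disjoint _ ?_ (W₂.sub_mem hw hw')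
  rw [hW₁, LinearMap.mem_ker, LinearMap.sub_apply, LinearMap.id_apply, map_sub, sub_sub_sub_comm,
    h, sub_self]

/-- If `A = ker (z - 1) ⊕ W₂` then `(z - 1)A = (z - 1)W₂`: every `(z - 1)x` is `(z - 1)u` with
`u ∈ W₂` (the `W₂`-component of `x`). [folklore] -/
theorem localTubeSpan_centralSplit_exists_sub_eq (z : G) (W₁ W₂ : Submodule k A.V)
    (hW₁ : W₁ = LinearMap.ker (A.ρ z - LinearMap.id)) (hc : IsCompl W₁ W₂) {y : A.V}
    (hy : y ∈ LinearMap.range (A.ρ z - LinearMap.id)) :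
    ∃ u ∈ W₂, A.ρ z u - u = y := by
  obtain ⟨x, rfl⟩ := hy
  have hx : x ∈ W₁ ⊔ W₂ := by
    rw [hc.sup_eq_top]
    exact Submodule.mem_top
  obtain ⟨x₁, hx₁, x₂, hx₂, rfl⟩ := Submodule.mem_sup.1 hx
  refine ⟨x₂, hx₂, ?_⟩
  rw [hW₁, LinearMap.mem_ker] at hx₁
  rw [map_add, hx₁, zero_add, LinearMap.sub_apply, LinearMap.id_apply]

/-! ### `H¹(G, (z - 1)A) = 0` for a central `z` -/

/-- For a central `z` and a `1`-cocycle `ψ` of a `G`-stable submodule `W ≤ A`: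
`(z - 1)ψ(g) = (g - 1)ψ(z)` in `A` (compare `ψ(zg) = z·ψ(g) + ψ(z)` with
`ψ(gz) = g·ψ(z) + ψ(g)`). [folklore] -/
theorem localTubeSpan_centralSplit_cocycle_comm (z : G) (hz : ∀ g : G, g * z = z * g)
    (W : Submodule k A.V) (hW : ∀ g : G, W ≤ W.comap (A.ρ g))
    (ψ : cocycles₁ (Rep.of (A.ρ.subrepresentation W hW))) (g : G) :
    A.ρ z ((ψ g : W) : A.V) - ψ g = A.ρ g ((ψ z : W) : A.V) - ψ z := by
  have e : ψ (z * g) = ψ (g * z) := by rw [hz g]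
  rw [(mem_cocycles₁_iff ψ).1 ψ.2 z g, (mem_cocycles₁_iff ψ).1 ψ.2 g z] at e
  have e' : A.ρ z ((ψ g : W) : A.V) + ψ z = A.ρ g ((ψ z : W) : A.V) + ψ g :=
    congrArg Subtype.val e
  rw [sub_eq_sub_iff_add_eq_add]
  exact e'

/-- **`H¹(G, (z - 1)A) = 0` for a central `z` with `A = ker (z - 1) ⊕ (z - 1)A`.**  Every
`1`-cocycle `ψ` of the subrepresentation `W₂ = (z - 1)A` is a coboundary: write `ψ(z) = (z - 1)u`
with `u ∈ W₂`; then `(z - 1)ψ(g) = (g - 1)ψ(z) = (g - 1)(z - 1)u = (z - 1)(g - 1)u`, and `z - 1`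
is injective on `W₂`, so `ψ(g) = g·u - u`. [folklore] -/
theorem localTubeSpan_centralSplit_exists_of_cocycles₁ (z : G) (hz : ∀ g : G, g * z = z * g)
    (W₁ W₂ : Submodule k A.V)
    (hW₁ : W₁ = LinearMap.ker (A.ρ z - LinearMap.id))
    (hW₂ : W₂ = LinearMap.range (A.ρ z - LinearMap.id))
    (h₂ : ∀ g : G, W₂ ≤ W₂.comap (A.ρ g)) (hc : IsCompl W₁ W₂)
    (ψ : cocycles₁ (Rep.of (A.ρ.subrepresentation W₂ h₂))) :
    ∃ u : W₂, ∀ g : G, A.ρ.subrepresentation W₂ h₂ g u - u = ψ g := by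
  -- `ψ z ∈ W₂ = (z - 1)A` is `(z - 1)u` with `u ∈ W₂`
  obtain ⟨u, hu, hψz⟩ :=
    localTubeSpan_centralSplit_exists_sub_eq A z W₁ W₂ hW₁ hc (hW₂.le (ψ z).2)
  refine ⟨⟨u, hu⟩, fun g => Subtype.ext ?_⟩
  -- read in `A`: `g·u - u = ψ g`, by injectivity of `z - 1` on `W₂`
  change A.ρ g u - u = ((ψ g : W₂) : A.V)
  refine localTubeSpan_centralSplit_eq_of_sub_eq A z W₁ W₂ hW₁ hc (W₂.sub_mem (h₂ g hu) hu)
    (ψ g).2 ?_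
  rw [localTubeSpan_centralSplit_cocycle_comm A z hz W₂ h₂ ψ g, ← hψz, map_sub, map_sub,
    localTubeSpan_centralSplit_rho_comm A z hz g u]
  abel

/-! ### The central splitting -/

/-- **Cyclic detection and a central splitting** (stub `stub_centralSplit` of the line).  For a
central element `z ∈ G` such that `A = ker (z - 1) ⊕ (z - 1)A` (automatic for `z` of finite
order in characteristic `0`, e.g. `ρ(z) = -1`), Schnell's third map
`H¹(G, A) → ∏_g A/(g - 1)A` is injective iff the third map of the stable subrepresentation
`A^z = ker (z - 1)` is: both summands are `G`-stable (`z` is central), detection splits over the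
decomposition (`localTubeSpan_injective_evalCoinv_iff_of_isCompl`), and detection for `(z - 1)A`
is automatic because `H¹(G, (z - 1)A) = 0`
(`localTubeSpan_centralSplit_exists_of_cocycles₁`). [folklore] -/
theorem localTubeSpan_centralSplit (z : G) (hz : ∀ g : G, g * z = z * g) (W₁ W₂ : Submodule k A.V)
    (hW₁ : W₁ = LinearMap.ker (A.ρ z - LinearMap.id))
    (hW₂ : W₂ = LinearMap.range (A.ρ z - LinearMap.id))
    (h₁ : ∀ g : G, W₁ ≤ W₁.comap (A.ρ g)) (hc : IsCompl W₁ W₂) :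
    Function.Injective (evalCoinv A) ↔
      Function.Injective (evalCoinv (Rep.of (A.ρ.subrepresentation W₁ h₁))) := by
  -- `(z - 1)A` is `G`-stable because `z` is central
  have h₂ : ∀ g : G, W₂ ≤ W₂.comap (A.ρ g) := fun g => by
    rw [hW₂]
    exact localTubeSpan_centralSplit_range_le_comap A z hz g
  -- detection for `(z - 1)A` is automatic: every cocycle is a coboundary
  have hinj₂ : Function.Injective (evalCoinv (Rep.of (A.ρ.subrepresentation W₂ h₂))) :=
    (localTubeSpan_injective_evalCoinv_iff_forall_cocycles₁ _).2 fun ψ _ =>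
      localTubeSpan_centralSplit_exists_of_cocycles₁ A z hz W₁ W₂ hW₁ hW₂ h₂ hc ψ
  rw [localTubeSpan_injective_evalCoinv_iff_of_isCompl A W₁ W₂ h₁ h₂ hc]
  exact ⟨fun h => h.1, fun h => ⟨h, hinj₂⟩⟩

end Summit.HodgeConjecture.HodgeConjecture.Theorems

end
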